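import Literature.IUT.LogVolume.ArithmeticDivisorsFrdBridge
import Literature.IUT.LogVolume.PrincipalArithmeticDivisorsSpan
import Literature.AlgebraicGeometry.Frobenioids.ArithmeticDegreeRealification
import Literature.AlgebraicGeometry.Frobenioids.MotivatingExamplesSubProofs2
import HarnessLib

/-!
# Frobenioids I, Thm. 6.4 (iv) (with (i)–(ii) read integrally): a homomorphism of arithmetic-divisor groups
# `Φ(L₁)^gp → Φ(L₂)^gp` carrying effective to effective and principal to principal MULTIPLIES DEGREES BY A
# CONSTANT — so along "generator ↦ generator" it rescales all `log N(w)` by one `c > 0`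

Mochizuki, *The geometry of Frobenioids I: the general theory*, Kyushu J. Math. **62** (2008) 293–400, §6,
Thm. 6.4 (i) p. 115 l. 27–33 ("it suffices to verify that the image of `Φ^birat(L) ⊗_ℤ ℝ = (L^×) ⊗_ℤ ℝ` in
`(Φ^rlf_factor)^gp(L)` is equal to the set of elements … whose image under `deg^arith_L` is `0`. But this is an
immediate consequence of the well-known Dirichlet unit theorem"), (ii) p. 115 l. 34 – p. 116 l. 3 (the degree
`deg(Ψ^rlf)`), (iv) proof p. 116 l. 25–27 ("`deg^arith_{L_i}` maps a generator of the monoid `Φ_i(L_i)_{v_i}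
(≅ ℤ_{≥0})` to `log(p)`") [cite: MochizukiFrdI2008, Thm. 6.4 (iv) p.116].

PROOF-ONLY file (cell abc-iut, `plan/L1/SUBDAG-FrdI-Thm64.md` §G, data-level input of the composition row
T64iv/L08 — the REALIFICATION-FREE reading of (ii)⇒(iv) for an equivalence of the Frobenioids themselves;
L1-lead R108 (4) row (G); seat abc-iut-L1-d7).  Pure number-field algebra over abc-iut-L1-t3's
`ArithDivisor L = (FinitePlace L →₀ ℤ) × (InfinitePlace L → ℝ)` / `arithDegree` / `principalArithDivisor` and the
LogVolume trunk's `ADiv_ℝ(L)` (bridge `ADivisor.ofArithDivisor`, Dirichlet–class-group package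
`span_APrc_eq_ker_degF`):
* `addMonoidHom_real_apply_eq_mul_of_monotone`, `addMonoidHom_pi_apply_smul_of_monotone` — an additive and
  MONOTONE map `ℝ →+ ℝ`, resp. functional on `ι → ℝ`, is `ℝ`-linear (additivity gives `ℚ`-linearity, monotonicity
  and density of `ℚ` the rest) — the "order structure of `ℝ`" step of (ii);
* **`exists_arithDegree_comp_eq_mul`** — if `eG : Φ(L₁)^gp →+ Φ(L₂)^gp` restricts to a homomorphism
  `eE : Φ(L₁) → Φ(L₂)` of the EFFECTIVE divisors and carries principal divisors `div(L₁^×)` into principal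
  divisors, then `deg^arith_{L₂} ∘ eG = c · deg^arith_{L₁}` for ONE real `c`: both sides are `ℝ`-linear on
  `Φ(L₁)^gp ⊗ ℝ = ADiv_ℝ(L₁)` (the archimedean part by the monotone-additive lemma, effectivity giving
  monotonicity) and kill the `ℝ`-span of the principal divisors, which IS the kernel of the degree (Dirichlet unit
  theorem + finiteness of the class group, `span_APrc_eq_ker_degF`);
* **`exists_logNorm_eq_mul_of_transport`** — if moreover `eE δ_w = δ_{π w}` ("generator ↦ generator", row
  T64iv/L01), then `log N(π w) = c · log N(w)` for all finite `w`, with `c > 0`: exactly the hypothesis `hgen` of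
  `Thm64iv_of_logNorm_transport` (`MotivatingExamplesThm64ivDegOne.lean`), which then forces `c = 1` and, for
  `L₁` Galois over `ℚ`, `L₁ ≅ L₂`.
No definitions, no named facts; classical; nothing here bears on [IUTchIII] Cor. 3.12 or asserts anything about abc.
-/

noncomputable section

namespace Literature.AlgebraicGeometry.Frobenioids

open NumberField IsDedekindDomain Literature.IUT.LogVolume

/-! ### Additive + monotone ⟹ `ℝ`-linear -/

/-- An additive MONOTONE map `ψ : ℝ → ℝ` is `x ↦ ψ(1) · x` (additivity gives `ψ(q x) = q ψ(x)` for rational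
`q`; squeeze between rationals). [cite: MochizukiFrdI2008, Thm. 6.4 (ii) p.115] -/
theorem addMonoidHom_real_apply_eq_mul_of_monotone (ψ : ℝ →+ ℝ) (hψ : Monotone ψ) (x : ℝ) :
    ψ x = ψ 1 * x := by
  set c := ψ 1 with hc_def
  have hrat : ∀ (q : ℚ) (y : ℝ), ψ ((q : ℝ) * y) = (q : ℝ) * ψ y := fun q y => by
    have := map_rat_smul ψ q y
    simpa [Rat.smul_def] using this
  have hratc : ∀ q : ℚ, ψ (q : ℝ) = c * q := fun q => by
    have := hrat q 1
    rw [mul_one] at this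
    rw [this, hc_def, mul_comm]
  have hc0 : 0 ≤ c := by
    have h01 : ψ 0 ≤ ψ 1 := hψ zero_le_one
    rwa [map_zero] at h01
  -- squeeze: for rationals `q₁ < x < q₂`, `c q₁ ≤ ψ x ≤ c q₂` and `c q₁ ≤ c x ≤ c q₂`
  apply le_antisymm
  · refine le_of_forall_pos_le_add fun ε hε => ?_
    obtain ⟨q, hxq, hqx⟩ := exists_rat_btwn (show x < x + ε / (c + 1) by
      have : 0 < ε / (c + 1) := div_pos hε (by linarith); linarith)
    calc ψ x ≤ ψ q := hψ hxq.le
      _ = c * q := hratc q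
      _ ≤ c * (x + ε / (c + 1)) := mul_le_mul_of_nonneg_left hqx.le hc0
      _ = c * x + c * (ε / (c + 1)) := by ring
      _ ≤ c * x + ε := by
        have h1 : c * (ε / (c + 1)) ≤ ε := by
          rw [mul_div_assoc', div_le_iff₀ (by linarith : (0 : ℝ) < c + 1)]
          nlinarith
        linarith
  · refine le_of_forall_pos_le_add fun ε hε => ?_
    obtain ⟨q, hqx, hxq⟩ := exists_rat_btwn (show x - ε / (c + 1) < x by
      have : 0 < ε / (c + 1) := div_pos hε (by linarith); linarith)
    calc c * x = c * (x - ε / (c + 1)) + c * (ε / (c + 1)) := by ring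
      _ ≤ c * q + ε := by
        have h1 : c * (ε / (c + 1)) ≤ ε := by
          rw [mul_div_assoc', div_le_iff₀ (by linarith : (0 : ℝ) < c + 1)]
          nlinarith
        have h2 : c * (x - ε / (c + 1)) ≤ c * q := mul_le_mul_of_nonneg_left hqx.le hc0
        linarith
      _ = ψ q + ε := by rw [hratc q]
      _ ≤ ψ x + ε := by
        have : ψ q ≤ ψ x := hψ hxq.le
        linarith

/-- An additive MONOTONE (for the pointwise order) functional `φ` on `ι → ℝ` is `ℝ`-homogeneous:
`φ (c • t) = c · φ t`. [cite: MochizukiFrdI2008, Thm. 6.4 (ii) p.115] -/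
theorem addMonoidHom_pi_apply_smul_of_monotone {ι : Type*} (φ : (ι → ℝ) →+ ℝ) (hφ : Monotone φ)
    (c : ℝ) (t : ι → ℝ) : φ (c • t) = c * φ t := by
  -- first for `t ≥ 0`, where `a ↦ φ (a • t)` is additive and monotone
  have key : ∀ s : ι → ℝ, 0 ≤ s → φ (c • s) = c * φ s := by
    intro s hs
    let ψ : ℝ →+ ℝ :=
      { toFun := fun a => φ (a • s)
        map_zero' := by rw [zero_smul, map_zero]
        map_add' := fun a b => by rw [add_smul, map_add] }
    have hψ : Monotone ψ := fun a b hab => hφ (smul_le_smul_of_nonneg_right hab hs)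
    have h := addMonoidHom_real_apply_eq_mul_of_monotone ψ hψ c
    change φ (c • s) = φ ((1 : ℝ) • s) * c at h
    rw [one_smul] at h
    rw [h, mul_comm]
  -- general `t = t⁺ − t⁻`
  have ht : t = (fun i => max (t i) 0) - fun i => max (-t i) 0 := by
    funext i
    simp only [Pi.sub_apply, max_zero_sub_max_neg_zero_eq_self]
  have hpos : (0 : ι → ℝ) ≤ fun i => max (t i) 0 := fun i => le_max_right _ _
  have hneg : (0 : ι → ℝ) ≤ fun i => max (-t i) 0 := fun i => le_max_right _ _
  rw [ht, smul_sub, map_sub, map_sub, key _ hpos, key _ hneg, mul_sub]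

/-! ### Degree transport along a homomorphism of arithmetic-divisor groups -/

section Transport

variable {L₁ : Type} [Field L₁] [NumberField L₁] {L₂ : Type} [Field L₂] [NumberField L₂]

/-- The degree of THE GENERATOR `δ_w` (as an arithmetic divisor) is `log N(w)`.
[cite: MochizukiFrdI2008, Ex. 6.3 p.114] -/
theorem arithDegree_toArithDivisor_single (L : Type) [Field L] [NumberField L] (w : FinitePlace L) :
    arithDegree L (EffArithDivisor.toArithDivisor L (Finsupp.single w 1, 0)) = logNorm w := by
  have h : EffArithDivisor.toArithDivisor L (Finsupp.single w 1, 0) = (Finsupp.single w (1 : ℤ), 0) := by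
    refine Prod.ext (Finsupp.ext fun w' => ?_) (funext fun v => ?_)
    · rw [EffArithDivisor.toArithDivisor_fst]
      by_cases hw : w' = w
      · subst hw; simp
      · simp [Finsupp.single_eq_of_ne hw]
    · simp
  rw [h, arithDegree_single, Int.cast_one, one_mul, logNorm]

/-- The archimedean part of `Φ(L)^gp`: `(0, t)` with `t ≥ 0` is the effective divisor `(0, t)`.
[cite: MochizukiFrdI2008, Ex. 6.3 p.113] -/
theorem arch_eq_toArithDivisor (L : Type) [Field L] [NumberField L] {t : InfinitePlace L → ℝ} (ht : 0 ≤ t) :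
    ((0, t) : ArithDivisor L) = EffArithDivisor.toArithDivisor L (0, fun v => ⟨t v, ht v⟩) := by
  refine Prod.ext (Finsupp.ext fun w => ?_) (funext fun v => ?_)
  · simp
  · rw [EffArithDivisor.toArithDivisor_snd]
    rfl

/-- `Φ ⊆ Φ^gp` on generators: `ι(δ_w) = (single w 1, 0)`. [cite: MochizukiFrdI2008, Ex. 6.3 p.113] -/
theorem toArithDivisor_single (L : Type) [Field L] [NumberField L] (w : FinitePlace L) :
    EffArithDivisor.toArithDivisor L (Finsupp.single w 1, 0) = (Finsupp.single w (1 : ℤ), 0) := by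
  refine Prod.ext (Finsupp.ext fun w' => ?_) (funext fun v => ?_)
  · rw [EffArithDivisor.toArithDivisor_fst]
    by_cases hw : w' = w
    · subst hw; simp
    · simp [Finsupp.single_eq_of_ne hw]
  · simp

/-- An additive map out of `Φ(L)^gp` on a finitely supported finite part: `ψ (f, 0) = Σ_w f_w · ψ(single w 1, 0)`.
[cite: MochizukiFrdI2008, Ex. 6.3 p.113] -/
theorem addMonoidHom_apply_fst_eq_sum (L : Type) [Field L] [NumberField L] (ψ : ArithDivisor L →+ ℝ)
    (f : FinitePlace L →₀ ℤ) :
    ψ (f, 0) = f.sum fun w n => (n : ℝ) * ψ (Finsupp.single w 1, 0) := by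
  have hdec : ((f, 0) : ArithDivisor L) = f.sum fun w n => n • ((Finsupp.single w (1 : ℤ), 0) : ArithDivisor L) := by
    refine Prod.ext ?_ ?_
    · simp only [Finsupp.sum, Prod.fst_sum, Prod.smul_fst, Finsupp.smul_single, smul_eq_mul, mul_one]
      exact (Finsupp.sum_single f).symm
    · simp only [Finsupp.sum, Prod.snd_sum, Prod.smul_snd, smul_zero, Finset.sum_const_zero]
  rw [hdec, map_finsuppSum]
  refine Finsupp.sum_congr fun w _ => ?_
  rw [map_zsmul, zsmul_eq_mul]

/-- **Degree transport** (the realification-free core of [FrdI] Thm. 6.4 (ii) for an equivalence of the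
Frobenioids themselves): a homomorphism `eG : Φ(L₁)^gp → Φ(L₂)^gp` that restricts to the EFFECTIVE divisors
(`eE`) and carries principal divisors to principal divisors multiplies the arithmetic degree by ONE real
constant `c`.  (Both `deg₂ ∘ eG` and `deg₁` extend to `ℝ`-linear functionals on `ADiv_ℝ(L₁)` killing the
`ℝ`-span of the principal divisors — the archimedean part of `deg₂ ∘ eG` is monotone additive, hence linear —
and that span IS `Ker(deg₁)`: Dirichlet's unit theorem and the finiteness of the class group,
`span_APrc_eq_ker_degF`.) [cite: MochizukiFrdI2008, Thm. 6.4 (ii) p.115] -/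
theorem exists_arithDegree_comp_eq_mul (eG : ArithDivisor L₁ →+ ArithDivisor L₂)
    (eE : EffArithDivisor L₁ →+ EffArithDivisor L₂)
    (heG : ∀ D, eG (EffArithDivisor.toArithDivisor L₁ D) = EffArithDivisor.toArithDivisor L₂ (eE D))
    (hprinc : ∀ u : L₁ˣ, ∃ v : L₂ˣ, eG (principalArithDivisor L₁ u) = principalArithDivisor L₂ v) :
    ∃ c : ℝ, ∀ d, arithDegree L₂ (eG d) = c * arithDegree L₁ d := by
  classical
  -- `ψ := deg₂ ∘ eG`
  let ψ : ArithDivisor L₁ →+ ℝ := (arithDegree L₂).comp eG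
  have hψ : ∀ d, ψ d = arithDegree L₂ (eG d) := fun d => rfl
  -- the archimedean part of `ψ` is additive and monotone, hence `ℝ`-linear
  let θ : (InfinitePlace L₁ → ℝ) →+ ℝ := ψ.comp (AddMonoidHom.inr _ _)
  have hθ_apply : ∀ t, θ t = ψ (0, t) := fun t => rfl
  have hθ_nonneg : ∀ t, 0 ≤ t → 0 ≤ θ t := fun t ht => by
    rw [hθ_apply, hψ, arch_eq_toArithDivisor L₁ ht, heG]
    exact arithDegree_toArithDivisor_nonneg L₂ _
  have hθ_mono : Monotone θ := fun a b hab => by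
    have : 0 ≤ θ (b - a) := hθ_nonneg _ (sub_nonneg.mpr hab)
    rw [map_sub] at this
    linarith
  have hθ_smul : ∀ (c : ℝ) t, θ (c • t) = c * θ t := addMonoidHom_pi_apply_smul_of_monotone θ hθ_mono
  have hθ_sum : ∀ t : InfinitePlace L₁ → ℝ, θ t = ∑ v, t v * θ (Pi.single v 1) := fun t => by
    conv_lhs => rw [pi_eq_sum_univ' t]
    rw [map_sum]
    exact Finset.sum_congr rfl fun v _ => hθ_smul _ _
  -- the `ℝ`-linear functional `Λ` on `ADiv_ℝ(L₁)` extending `ψ` along `ofArithDivisor`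
  let κ : Place L₁ → ℝ := Sum.elim (fun v => ((v.mult : ℝ))⁻¹ * θ (Pi.single v 1))
    (fun 𝔳 => ψ (Finsupp.single (FinitePlace.mk 𝔳) 1, 0))
  let Λ : ADivisor L₁ →ₗ[ℝ] ℝ := Finsupp.linearCombination ℝ κ
  have hΛ : ∀ d : ArithDivisor L₁, Λ (ADivisor.ofArithDivisor L₁ d) = ψ d := by
    rintro ⟨f, t⟩
    have hof : ADivisor.ofArithDivisor L₁ (f, t) = (ADivisor.archOfArith L₁ t).sumElim (ADivisor.finOfArith L₁ f) := rfl
    rw [hof, Finsupp.linearCombination_apply, Finsupp.sum_sumElim]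
    simp only [Function.comp_def]
    -- archimedean part
    have harch : ((ADivisor.archOfArith L₁ t).sum fun v a => a • κ (Sum.inl v)) = ψ (0, t) := by
      rw [Finsupp.sum_fintype _ _ (fun _ => by simp), ← hθ_apply, hθ_sum]
      refine Finset.sum_congr rfl fun v _ => ?_
      simp only [ADivisor.archOfArith_apply, κ, Sum.elim_inl, smul_eq_mul]
      field_simp
    -- finite part
    have hfinp : ((ADivisor.finOfArith L₁ f).sum fun 𝔳 a => a • κ (Sum.inr 𝔳)) = ψ (f, 0) := by
      rw [ADivisor.finOfArith, AddMonoidHom.coe_comp, Function.comp_apply,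
        Finsupp.mapDomain.addMonoidHom_apply, Finsupp.mapRange.addMonoidHom_apply,
        Finsupp.sum_mapDomain_index_inj FinitePlace.maximalIdeal_injective,
        Finsupp.sum_mapRange_index (fun _ => by simp), addMonoidHom_apply_fst_eq_sum]
      refine Finsupp.sum_congr fun w _ => ?_
      simp only [κ, Sum.elim_inr, Int.coe_castAddHom, smul_eq_mul, FinitePlace.mk_maximalIdeal]
    rw [harch, hfinp, ← map_add]
    congr 1
    ext <;> simp
  -- `Λ` kills the principal divisors, hence (Dirichlet + class group) the kernel of the degree
  have hker : LinearMap.ker (degF L₁) ≤ LinearMap.ker Λ := by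
    rw [← span_APrc_eq_ker_degF, Submodule.span_le]
    rintro a ⟨x, hx, rfl⟩
    obtain ⟨v, hv⟩ := hprinc (Units.mk0 x hx)
    rw [SetLike.mem_coe, LinearMap.mem_ker, ← Units.val_mk0 hx, ← ofArithDivisor_principalArithDivisor,
      hΛ, hψ, hv, arithDegree_principalArithDivisor]
  -- so `Λ = c · deg` for `c := Λ a₀`, `deg a₀ = 1`
  obtain ⟨w₀⟩ := (inferInstance : Nonempty (InfinitePlace L₁))
  refine ⟨Λ (ADivisor.of (Sum.inl w₀) 1), fun d => ?_⟩
  have hmem : ADivisor.ofArithDivisor L₁ d - (degF L₁ (ADivisor.ofArithDivisor L₁ d)) • ADivisor.of (Sum.inl w₀) 1 ∈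
      LinearMap.ker (degF L₁) := by
    rw [LinearMap.mem_ker, map_sub, map_smul, degF_of_inl, smul_eq_mul, mul_one, sub_self]
  have h0 := hker hmem
  rw [LinearMap.mem_ker, map_sub, map_smul, smul_eq_mul, sub_eq_zero, hΛ, hψ, degF_ofArithDivisor] at h0
  rw [h0, mul_comm]

/-- **"Generator ↦ generator" rescales all norms by one constant**: if moreover `eE δ_w = δ_{π w}` at the
finite places (row T64iv/L01, `ArithmeticDivisorsMonoidIsoPlaces.lean`), then `log N(π w) = c · log N(w)` for
every finite `w`, with `c > 0` — the hypothesis `hgen` of `Thm64iv_of_logNorm_transport`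
(`MotivatingExamplesThm64ivDegOne.lean`: then `c = 1`, and `L₁ ≅ L₂` if `L₁` is Galois over `ℚ`).
[cite: MochizukiFrdI2008, Thm. 6.4 (iv) p.116] -/
theorem exists_logNorm_eq_mul_of_transport (eG : ArithDivisor L₁ →+ ArithDivisor L₂)
    (eE : EffArithDivisor L₁ →+ EffArithDivisor L₂)
    (heG : ∀ D, eG (EffArithDivisor.toArithDivisor L₁ D) = EffArithDivisor.toArithDivisor L₂ (eE D))
    (hprinc : ∀ u : L₁ˣ, ∃ v : L₂ˣ, eG (principalArithDivisor L₁ u) = principalArithDivisor L₂ v)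
    (π : FinitePlace L₁ → FinitePlace L₂) (hπ : ∀ w, eE (Finsupp.single w 1, 0) = (Finsupp.single (π w) 1, 0)) :
    ∃ c : ℝ, 0 < c ∧ ∀ w, logNorm (π w) = c * logNorm w := by
  obtain ⟨c, hc⟩ := exists_arithDegree_comp_eq_mul eG eE heG hprinc
  have hgen : ∀ w, logNorm (π w) = c * logNorm w := fun w => by
    rw [← arithDegree_toArithDivisor_single L₂ (π w), ← hπ, ← heG, hc, arithDegree_toArithDivisor_single]
  haveI := infinite_finitePlace (L := L₁)
  obtain ⟨w⟩ := (inferInstance : Nonempty (FinitePlace L₁))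
  have h1 : 0 < logNorm w := Real.log_pos (by exact_mod_cast NumberField.HeightOneSpectrum.one_lt_absNorm w.maximalIdeal)
  have h2 : 0 < logNorm (π w) :=
    Real.log_pos (by exact_mod_cast NumberField.HeightOneSpectrum.one_lt_absNorm (π w).maximalIdeal)
  refine ⟨c, ?_, hgen⟩
  rw [hgen w] at h2
  exact pos_of_mul_pos_left h2 h1.le

end Transport

end Literature.AlgebraicGeometry.Frobenioids

end
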